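import Literature.Computability.MetaComplexity.AvgCaseCertifiedHardness
import Literature.Computability.MetaComplexity.NWPseudorandom
import Literature.Computability.Complexity.SamplingChernoff
import HarnessLib

/-!
# Certified AVERAGE-CASE hard truth tables from one-sided heuristics for `coNP` on the uniform ensemble
# (Köbler–Schuler; Hirahara 2021, Lemma 3.4, item 2 — the hardness the Nisan–Wigderson generator consumes)

Topic `Literature/Computability/MetaComplexity`, companion of `AvgCaseCertifiedHardness.lean` (which
certifies WORST-case hardness `circuitSizeOver B2 f > 2^{⌊ℓ/4⌋}` under `coNP × {U} ⊆ Avg¹_{1-n^{-c}} P`).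
Item 2 of the proof sketch of Hirahara's Lemma 3.4 (ECCC TR21-058, p. 20: "`coNP × {U} ⊆ Avg¹_{1-n^{-c}} P`
implies `pr-MA = pr-NP` [KS04]") derandomises Merlin–Arthur games by a pseudorandom generator armed with
a certified table. The generator of the tree that stretches `O(log N)` seed bits from a table
(`NWTableGenerator.lean`, Arora–Barak Thm. 20.6 / Lemma 20.15) wants an AVERAGE-case hard function
(`AvgHardAtLeast`, Arora–Barak Def. 19.1). Instead of certifying worst-case hardness and amplifying it
(Impagliazzo–Wigderson), this file certifies average-case hardness DIRECTLY — the same Köbler–Schuler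
mechanism run on the `coNP` property "no small circuit agrees with the table on a `1/2 + 1/S` fraction",
which random tables have with overwhelming probability (circuit counting × Hoeffding). This is a
deliberate shortcut relative to the printed chain (KS04 + IW97), recorded as such; the statement proved
downstream (`pr-MA ⊆ pr-NP` under the hypothesis) is the printed one.

* `ApproxTables S` — the truth tables `tt(f)`, `f : {0,1}^ℓ → {0,1}`, such that SOME `B₂`-circuit of size
  `≤ S ℓ` agrees with `f` on at least `(1/2 + 1/S ℓ) · 2^ℓ` inputs, written with natural numbers
  (`2^ℓ (S ℓ + 2) ≤ 2 · S ℓ · #{x | C(x) = f(x)}`); `truthTable_mem_ApproxTables_iff`;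
* `avgHardAtLeast_of_not_mem` — a table outside `ApproxTables S` (with `S ℓ ≥ 1`) is the table of a
  function with `H_avg(f) ≥ S ℓ`;
* `card_highAgreement_le` — for a fixed `h`, the functions `f` agreeing with `h` on `≥ (1/2 + 1/S) 2^ℓ`
  inputs number `≤ exp(-2 · 2^ℓ / S²) · 2^{2^ℓ}` (Hoeffding, `card_upperDeviation_le_exp` of
  `SamplingChernoff.lean`, through the injection `f ↦ (x ↦ [h x = f x])`);
* **`uniformProb_ApproxTables_le`** — `Pr_{w ← {0,1}^{2^ℓ}}[w ∈ ApproxTables S] ≤ 2^{9(ℓ + S ℓ + 2)²} ·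
  exp(-2 · 2^ℓ / (S ℓ)²)` (the count `ncard_sizeClass_B2_le` of functions with small circuits times the
  previous bound);
* **`exists_avgCertifier`** — under `coNP × {U} ⊆ Avg¹_{1-n^{-c}} P` and `ApproxTables S ∈ NP`: a
  polynomial-time `A(w; 1ⁿ)` and `c` with (soundness) `A(tt f; 1^{2^ℓ}) = 1 ⟹ H_avg(f) ≥ S ℓ` and
  (abundance) `Pr[A(w; 1^{2^ℓ}) = 1] ≥ (2^ℓ)^{-c} - 2^{9(ℓ+S ℓ+2)²} exp(-2·2^ℓ/(S ℓ)²)`;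
* the threshold `eighthExp ℓ = 2^{⌊ℓ/8⌋}`: `exp_neg_natCast_le` (`exp(-N) ≤ 1/2^N`), `exponent_le_eighth`,
  `density_eighthExp_le` (the bound is `≤ 1/(2 (2^ℓ)^c)` for `ℓ ≥ 8(8c + 7)`), and
  **`exists_avgCertifier_eighthExp`**: soundness `H_avg(f) ≥ 2^{⌊ℓ/8⌋}`, abundance `≥ 1/(2 (2^ℓ)^c)` and
  non-emptiness for all `ℓ ≥ ℓ₀`, GIVEN `ApproxTables eighthExp ∈ NP` (proved in the sibling
  `AvgHardTablesNP.lean`).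

Everything is proved; the definitions are the language `ApproxTables` and the threshold `eighthExp`
(proof devices, no named facts). Nothing duplicates the tree (searched `ApproxTables`, `AvgHard`,
`certif`, `agreement.*Hoeffding`: the worst-case certifier is `CertifiedHard.exists_certifier`).

## References

* S. Hirahara, *Average-case hardness of NP from exponential worst-case hardness assumptions*,
  ECCC TR21-058 (2021), Lemma 3.4, proof sketch, item 2 (p. 20), Def. 3.3 [Hirahara2021].
* J. Köbler, R. Schuler, *Average-case intractability vs. worst-case intractability*, Inform. and
  Comput. 190 (2004) 1–17 (the cited source [KS04]).
* S. Arora, B. Barak, *Computational Complexity: A Modern Approach*, CUP 2009, Def. 19.1 (`H_avg`),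
  Thm. 6.21 (counting circuits), Thm. 20.6 [AroraBarakCC2009].
* W. Hoeffding, JASA 58 (1963), Thm. 1 (through `SamplingChernoff.lean`).
-/

noncomputable section

namespace Literature.Computability.MetaComplexity

open _root_.Computability Complexity Complexity.Classes Complexity.Nondeterministic Finset Real
open Literature.Computability.Learning

namespace AvgHardTables

/-! ### A. Tables with a good small approximator -/

/-- **Tables of approximable functions**: `tt(f) ∈ ApproxTables S` iff some `B₂`-circuit of size
`≤ S ℓ` (`ℓ` the arity) agrees with `f` on at least a `1/2 + 1/S ℓ` fraction of the inputs, in the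
integer form `2^ℓ (S ℓ + 2) ≤ 2 · S ℓ · #{x | C(x) = f(x)}`. Strings that are not truth tables are not
in the language. (The complement inside the tables of arity `ℓ` is "`H_avg(f) ≥ S ℓ`", Arora–Barak
Def. 19.1.) [cite: AroraBarakCC2009, Def. 19.1] -/
def ApproxTables (S : ℕ → ℕ) : Language Bool :=
  {w | ∃ (ℓ : ℕ) (f : (Fin ℓ → Bool) → Bool), w = truthTable f ∧
      ∃ C : Circuit (Fin ℓ), C.IsOver B2 ∧ C.size ≤ S ℓ ∧
        2 ^ ℓ * (S ℓ + 2) ≤ 2 * S ℓ * #{x : Fin ℓ → Bool | C.eval x = f x}}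

/-- Membership of a truth table: the arity is determined by the length. [folklore] -/
theorem truthTable_mem_ApproxTables_iff (S : ℕ → ℕ) {ℓ : ℕ} (f : (Fin ℓ → Bool) → Bool) :
    truthTable f ∈ ApproxTables S ↔
      ∃ C : Circuit (Fin ℓ), C.IsOver B2 ∧ C.size ≤ S ℓ ∧
        2 ^ ℓ * (S ℓ + 2) ≤ 2 * S ℓ * #{x : Fin ℓ → Bool | C.eval x = f x} := by
  constructor
  · rintro ⟨ℓ', f', hw, hC⟩
    have hℓ : ℓ' = ℓ := by
      have h := congrArg List.length hw
      rw [length_truthTable, length_truthTable] at h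
      exact (Nat.pow_right_injective le_rfl h).symm
    subst hℓ
    have hf : f' = f := by
      have h2 : ofTruthTable (truthTable f') (length_truthTable _) =
          ofTruthTable (truthTable f) (length_truthTable _) := by
        congr 1
        exact hw.symm
      rwa [ofTruthTable_truthTable, ofTruthTable_truthTable] at h2
    subst hf
    exact hC
  · intro hC
    exact ⟨ℓ, f, rfl, hC⟩

/-- **Outside `ApproxTables S` every table is average-case hard**: if `S ℓ ≥ 1` and `tt(f) ∉ ApproxTables S`
then `H_avg(f) ≥ S ℓ` (every `B₂`-circuit of size `≤ S ℓ` agrees with `f` on `< 1/2 + 1/S ℓ`).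
[cite: AroraBarakCC2009, Def. 19.1] -/
theorem avgHardAtLeast_of_not_mem {S : ℕ → ℕ} {ℓ : ℕ} (hS : 1 ≤ S ℓ) {f : (Fin ℓ → Bool) → Bool}
    (h : truthTable f ∉ ApproxTables S) : AvgHardAtLeast f (S ℓ) := by
  intro C hB hsize
  have hsz : C.size ≤ S ℓ := by exact_mod_cast hsize
  have hnot : ¬ 2 ^ ℓ * (S ℓ + 2) ≤ 2 * S ℓ * #{x : Fin ℓ → Bool | C.eval x = f x} := fun hle =>
    h ((truthTable_mem_ApproxTables_iff S f).2 ⟨C, hB, hsz, hle⟩)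
  push Not at hnot
  have hlt : (2 * S ℓ * #{x : Fin ℓ → Bool | C.eval x = f x} : ℝ) < 2 ^ ℓ * (S ℓ + 2) := by
    exact_mod_cast hnot
  have hS' : (0 : ℝ) < S ℓ := by exact_mod_cast hS
  have h2 : (0 : ℝ) < 2 ^ ℓ := by positivity
  unfold agreement
  rw [Fintype.card_fun, Fintype.card_bool, Fintype.card_fin, Nat.cast_pow, Nat.cast_ofNat,
    div_lt_iff₀ h2]
  have : (1 / 2 + 1 / (S ℓ : ℝ)) * 2 ^ ℓ = 2 ^ ℓ * (S ℓ + 2) / (2 * S ℓ) := by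
    field_simp
  rw [this, lt_div_iff₀ (by positivity)]
  linarith

/-! ### B. Functions with a good fixed approximator are rare (Hoeffding) -/

/-- **For a fixed `h`, few functions agree with `h` on `≥ (1/2 + 1/S) 2^ℓ` inputs**:
`#{f | 2^ℓ (S + 2) ≤ 2 S #{x | h x = f x}} ≤ exp(-2 · 2^ℓ / S²) · 2^{2^ℓ}` (`S ≥ 1`): through the injection
`f ↦ (i ↦ [h(xᵢ) = f(xᵢ)])` into `{0,1}^{2^ℓ}` this is Hoeffding's upper tail for `2^ℓ` fair coins.
[cite: AroraBarakCC2009, Thm. 6.21 (proof idea: counting)] -/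
theorem card_highAgreement_le {ℓ : ℕ} (h : (Fin ℓ → Bool) → Bool) {S : ℕ} (hS : 1 ≤ S) :
    (#{f : (Fin ℓ → Bool) → Bool | 2 ^ ℓ * (S + 2) ≤ 2 * S * #{x : Fin ℓ → Bool | h x = f x}} : ℝ) ≤
      exp (-2 * (2 ^ ℓ : ℝ) / (S : ℝ) ^ 2) * 2 ^ (2 ^ ℓ) := by
  classical
  set m : ℕ := 2 ^ ℓ with hm
  set e : (Fin ℓ → Bool) ≃ Fin m := boolFunEquivFin ℓ with he
  -- the injection into indicator sequences
  set Ψ : ((Fin ℓ → Bool) → Bool) → (Fin m → Bool) := fun f i => decide (h (e.symm i) = f (e.symm i)) with hΨ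
  have hΨinj : Function.Injective Ψ := by
    intro f g hfg
    funext x
    have hx := congrFun hfg (e x)
    simp only [hΨ, Equiv.symm_apply_apply, decide_eq_decide] at hx
    cases hf : f x <;> cases hg : g x <;> cases hh : h x <;> simp_all
  -- the number of agreements is the number of `true`s of the sequence
  have hcount : ∀ f : (Fin ℓ → Bool) → Bool,
      #{x : Fin ℓ → Bool | h x = f x} = #{i : Fin m | Ψ f i = true} := by
    intro f
    refine Finset.card_equiv e (fun x => ?_)
    simp only [mem_filter, mem_univ, true_and, hΨ, Equiv.symm_apply_apply, decide_eq_true_eq]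
  -- Hoeffding for fair coins
  have hmpos : 0 < m := by positivity
  have hη : (0 : ℝ) ≤ 1 / S := by positivity
  have hH := card_upperDeviation_le_exp (fun b : Bool => b = true) hmpos hη
  have hgood : ((univ.filter fun b : Bool => b = true).card : ℝ) / Fintype.card Bool = 1 / 2 := by
    rw [Fintype.card_bool]
    have : (univ.filter fun b : Bool => b = true) = {true} := by ext b; simp
    rw [this, card_singleton]
    norm_num
  rw [hgood, Fintype.card_fun, Fintype.card_bool, Fintype.card_fin] at hH
  -- compare the two filters along `Ψ`
  have hS' : (0 : ℝ) < S := by exact_mod_cast hS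
  have hsub : ∀ f ∈ univ.filter (fun f : (Fin ℓ → Bool) → Bool =>
        2 ^ ℓ * (S + 2) ≤ 2 * S * #{x : Fin ℓ → Bool | h x = f x}),
      Ψ f ∈ univ.filter (fun ω : Fin m → Bool =>
        (m : ℝ) * (1 / S) ≤ ((univ.filter fun i => ω i = true).card : ℝ) - m * (1 / 2)) := by
    intro f hf
    rw [mem_filter] at hf ⊢
    refine ⟨mem_univ _, ?_⟩
    have h1 := hf.2
    rw [hcount f] at h1
    have h2 : ((2 ^ ℓ * (S + 2) : ℕ) : ℝ) ≤ ((2 * S * #{i : Fin m | Ψ f i = true} : ℕ) : ℝ) := by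
      exact_mod_cast h1
    push_cast at h2
    have hmR : (m : ℝ) = 2 ^ ℓ := by simp [hm]
    rw [hmR, mul_one_div, div_le_iff₀ hS']
    nlinarith [h2]
  have hcard := Finset.card_le_card_of_injOn Ψ hsub (hΨinj.injOn)
  have hcardR : (#{f : (Fin ℓ → Bool) → Bool | 2 ^ ℓ * (S + 2) ≤ 2 * S * #{x : Fin ℓ → Bool | h x = f x}} : ℝ) ≤
      ((univ.filter fun ω : Fin m → Bool =>
        (m : ℝ) * (1 / S) ≤ ((univ.filter fun i => ω i = true).card : ℝ) - m * (1 / 2)).card : ℝ) := by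
    exact_mod_cast hcard
  refine hcardR.trans (hH.trans (le_of_eq ?_))
  rw [hm]
  push_cast
  congr 1
  congr 1
  field_simp

/-! ### C. The density of `ApproxTables S` among tables of length `2^ℓ` -/

/-- **Approximable tables are rare**: `Pr_{w ← {0,1}^{2^ℓ}}[w ∈ ApproxTables S] ≤
2^{9(ℓ + S ℓ + 2)²} · exp(-2 · 2^ℓ/(S ℓ)²)` for `S ℓ ≥ 1` — at most `2^{9(ℓ+S ℓ+2)²}` functions are computed
by `B₂`-circuits of size `≤ S ℓ` (`ncard_sizeClass_B2_le`), and each is a good approximator of at most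
`exp(-2·2^ℓ/S²) · 2^{2^ℓ}` functions (`card_highAgreement_le`).
[cite: AroraBarakCC2009, Thm. 6.21 (proof), Def. 19.1] -/
theorem uniformProb_ApproxTables_le (S : ℕ → ℕ) (ℓ : ℕ) (hS : 1 ≤ S ℓ) :
    uniformProb (2 ^ ℓ) (ApproxTables S) ≤
      (2 : ℝ) ^ (9 * (ℓ + S ℓ + 2) ^ 2) * exp (-2 * (2 ^ ℓ : ℝ) / (S ℓ : ℝ) ^ 2) := by
  classical
  rw [uniformProb_eq_card_fun]
  rw [div_le_iff₀ (by positivity)]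
  -- transport tables to functions
  set φ : (Fin (2 ^ ℓ) → Bool) → ((Fin ℓ → Bool) → Bool) :=
    fun g => ofTruthTable (List.ofFn g) (by simp) with hφ
  set H : Finset ((Fin ℓ → Bool) → Bool) := (Set.toFinite (sizeClass B2 S ℓ)).toFinset with hH
  set Good : ((Fin ℓ → Bool) → Bool) → Finset ((Fin ℓ → Bool) → Bool) := fun h =>
    univ.filter fun f => 2 ^ ℓ * (S ℓ + 2) ≤ 2 * S ℓ * #{x : Fin ℓ → Bool | h x = f x} with hGood
  have hmaps : ∀ g ∈ (univ.filter fun g : Fin (2 ^ ℓ) → Bool => List.ofFn g ∈ ApproxTables S),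
      φ g ∈ H.biUnion Good := by
    intro g hg
    rw [mem_filter] at hg
    have htt : truthTable (φ g) = List.ofFn g := by simp only [hφ, truthTable_ofTruthTable]
    have hmem : truthTable (φ g) ∈ ApproxTables S := by rw [htt]; exact hg.2
    obtain ⟨C, hB, hsz, hle⟩ := (truthTable_mem_ApproxTables_iff S (φ g)).1 hmem
    rw [Finset.mem_biUnion]
    refine ⟨fun x => C.eval x, ?_, ?_⟩
    · rw [hH, Set.Finite.mem_toFinset, mem_sizeClass_iff]
      exact ⟨C, hB, fun _ => rfl, hsz⟩
    · rw [hGood, mem_filter]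
      exact ⟨mem_univ _, hle⟩
  have hinj : Set.InjOn φ ↑(univ.filter fun g : Fin (2 ^ ℓ) → Bool => List.ofFn g ∈ ApproxTables S) := by
    intro g₁ _ g₂ _ h
    have h' : truthTable (φ g₁) = truthTable (φ g₂) := by rw [h]
    simp only [hφ, truthTable_ofTruthTable] at h'
    exact List.ofFn_injective h'
  have hcard := Finset.card_le_card_of_injOn φ hmaps hinj
  have hbi : (H.biUnion Good).card ≤ ∑ h ∈ H, (Good h).card := Finset.card_biUnion_le
  have hHcard : H.card ≤ 2 ^ (9 * (ℓ + S ℓ + 2) ^ 2) := by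
    rw [hH, ← Set.ncard_eq_toFinset_card _ (Set.toFinite (sizeClass B2 S ℓ))]
    exact ncard_sizeClass_B2_le S ℓ
  have hsum : (∑ h ∈ H, ((Good h).card : ℝ)) ≤
      ∑ h ∈ H, exp (-2 * (2 ^ ℓ : ℝ) / (S ℓ : ℝ) ^ 2) * 2 ^ (2 ^ ℓ) :=
    Finset.sum_le_sum fun h _ => by rw [hGood]; exact card_highAgreement_le h hS
  rw [Finset.sum_const, nsmul_eq_mul] at hsum
  have hpos : (0 : ℝ) ≤ exp (-2 * (2 ^ ℓ : ℝ) / (S ℓ : ℝ) ^ 2) * 2 ^ (2 ^ ℓ) := by positivity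
  calc (#{g : Fin (2 ^ ℓ) → Bool | List.ofFn g ∈ ApproxTables S} : ℝ)
      ≤ ((H.biUnion Good).card : ℝ) := by exact_mod_cast hcard
    _ ≤ ∑ h ∈ H, ((Good h).card : ℝ) := by exact_mod_cast hbi
    _ ≤ (H.card : ℝ) * (exp (-2 * (2 ^ ℓ : ℝ) / (S ℓ : ℝ) ^ 2) * 2 ^ (2 ^ ℓ)) := hsum
    _ ≤ (2 : ℝ) ^ (9 * (ℓ + S ℓ + 2) ^ 2) * (exp (-2 * (2 ^ ℓ : ℝ) / (S ℓ : ℝ) ^ 2) * 2 ^ (2 ^ ℓ)) := by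
        refine mul_le_mul_of_nonneg_right ?_ hpos
        exact_mod_cast hHcard
    _ = (2 : ℝ) ^ (9 * (ℓ + S ℓ + 2) ^ 2) * exp (-2 * (2 ^ ℓ : ℝ) / (S ℓ : ℝ) ^ 2) * 2 ^ (2 ^ ℓ) := by ring

/-! ### D. The certifier extracted from a one-sided heuristic for `((ApproxTables S)ᶜ, U)` -/

/-- **Certified average-case hard truth tables (the Köbler–Schuler mechanism, average-case form).**
Assume `coNP × {U} ⊆ Avg¹_{1-n^{-c}} P`, `ApproxTables S ∈ NP` and `S ≥ 1`. Then there are a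
polynomial-time `A(w; 1ⁿ)` and a constant `c` such that (soundness) every accepted table
`A(tt(f); 1^{2^ℓ}) = 1` has `H_avg(f) ≥ S ℓ`, and (abundance)
`Pr_{w ← {0,1}^{2^ℓ}}[A(w; 1^{2^ℓ}) = 1] ≥ (2^ℓ)^{-c} - 2^{9(ℓ+S ℓ+2)²} exp(-2·2^ℓ/(S ℓ)²)`: the one-sided
heuristic for `((ApproxTables S)ᶜ, U) ∈ coNP × {U}` never accepts an approximable table and is correct
with probability `≥ n^{-c}`. [Hirahara 2021 (ECCC TR21-058), Lemma 3.4, proof sketch, item 2 (p. 20),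
Def. 3.3; Köbler–Schuler 2004] [cite: Hirahara2021, Lemma 3.4 (proof sketch, item 2)] -/
theorem exists_avgCertifier
    (hU : ∃ c : ℕ, distClass coNP {uniformEnsemble} ⊆ Avg1DeltaP fun n => 1 - 1 / (n : ℝ) ^ c)
    {S : ℕ → ℕ} (hS : ∀ ℓ, 1 ≤ S ℓ) (hNP : ApproxTables S ∈ NP) :
    ∃ (A : List Bool → ℕ → Bool) (c : ℕ),
      PolyTimeComputable paramEnc encodeBool (Function.uncurry A) ∧
      (∀ (ℓ : ℕ) (f : (Fin ℓ → Bool) → Bool), A (truthTable f) (2 ^ ℓ) = true →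
        AvgHardAtLeast f (S ℓ)) ∧
      ∀ ℓ : ℕ, 1 / ((2 : ℝ) ^ ℓ) ^ c -
          (2 : ℝ) ^ (9 * (ℓ + S ℓ + 2) ^ 2) * exp (-2 * (2 ^ ℓ : ℝ) / (S ℓ : ℝ) ^ 2) ≤
        uniformProb (2 ^ ℓ) {w | A w (2 ^ ℓ) = true} := by
  obtain ⟨c, hc⟩ := hU
  have hco : (ApproxTables S)ᶜ ∈ coNP := by
    change (ApproxTables S)ᶜᶜ ∈ NP
    rwa [compl_compl]
  have hQ : (⟨(ApproxTables S)ᶜ, uniformEnsemble⟩ : DistProblem) ∈ distClass coNP {uniformEnsemble} :=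
    ⟨hco, Set.mem_singleton _⟩
  obtain ⟨A, hA, h1, h2⟩ := hc hQ
  refine ⟨A, c, hA, fun ℓ f hacc => ?_, fun ℓ => ?_⟩
  · -- soundness: an accepted table is not approximable
    refine avgHardAtLeast_of_not_mem (hS ℓ) fun hmem => ?_
    have hsupp : truthTable f ∈ (uniformEnsemble (2 ^ ℓ)).support := by
      rw [mem_support_uniformEnsemble_iff, length_truthTable]
    have hfalse : A (truthTable f) (2 ^ ℓ) = false :=
      h1 (2 ^ ℓ) (truthTable f) hsupp (fun h => h hmem)
    rw [hfalse] at hacc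
    exact Bool.false_ne_true hacc
  · -- abundance: the success event lies inside `{A = 1} ∪ ApproxTables S`
    have hsub : {x : List Bool | A x (2 ^ ℓ) = (ApproxTables S)ᶜ.boolIndicator x} ⊆
        {w | A w (2 ^ ℓ) = true} ∪ ApproxTables S := by
      intro x hx
      by_cases hAx : A x (2 ^ ℓ) = true
      · exact Or.inl hAx
      · right
        have hAx' : A x (2 ^ ℓ) = false := by simpa using hAx
        have hind : (ApproxTables S)ᶜ.boolIndicator x = false := by
          rw [Set.mem_setOf_eq] at hx
          rw [← hx, hAx']
        have hnot : x ∉ (ApproxTables S)ᶜ := (Set.notMem_iff_boolIndicator _ _).2 hind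
        exact not_not.1 hnot
    have hsucc := h2 (2 ^ ℓ)
    change 1 - (1 - 1 / ((2 ^ ℓ : ℕ) : ℝ) ^ c) ≤
      uniformEnsemble.prob (2 ^ ℓ) {x | A x (2 ^ ℓ) = (ApproxTables S)ᶜ.boolIndicator x} at hsucc
    rw [prob_uniformEnsemble] at hsucc
    have hmono : uniformProb (2 ^ ℓ) {x : List Bool | A x (2 ^ ℓ) = (ApproxTables S)ᶜ.boolIndicator x} ≤
        uniformProb (2 ^ ℓ) ({w | A w (2 ^ ℓ) = true} ∪ ApproxTables S) := by
      classical
      unfold uniformProb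
      refine div_le_div_of_nonneg_right ?_ (by positivity)
      exact_mod_cast Finset.card_le_card fun r hr => by
        simp only [Finset.mem_filter, Finset.mem_univ, true_and] at hr ⊢
        exact hsub hr
    have hunion := uniformProb_union_le (2 ^ ℓ) {w | A w (2 ^ ℓ) = true} (ApproxTables S)
    have heasy := uniformProb_ApproxTables_le S ℓ (hS ℓ)
    push_cast at hsucc
    linarith

/-! ### E. A concrete threshold: `S(ℓ) = 2^{⌊ℓ/8⌋}` -/

/-- The threshold `2^{⌊ℓ/8⌋}` (exponential average-case hardness, as the Nisan–Wigderson generator of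
`NWTableGenerator.lean` wants it: `isSizePseudorandom_genTF_exp` with `d = 8`). [folklore] -/
def eighthExp (ℓ : ℕ) : ℕ := 2 ^ (ℓ / 8)

/-- `2^{⌊ℓ/8⌋} ≥ 1`. [folklore] -/
theorem one_le_eighthExp (ℓ : ℕ) : 1 ≤ eighthExp ℓ := Nat.one_le_two_pow

/-- `exp(-N) ≤ 1/2^N` for a natural number `N` (`e ≥ 2`). [folklore] -/
theorem exp_neg_natCast_le (N : ℕ) : exp (-(N : ℝ)) ≤ 1 / (2 : ℝ) ^ N := by
  rw [exp_neg, one_div]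
  refine inv_anti₀ (by positivity) ?_
  have h2 : (2 : ℝ) ≤ exp 1 := by
    have := add_one_le_exp (1 : ℝ)
    linarith
  calc (2 : ℝ) ^ N ≤ (exp 1) ^ N := pow_le_pow_left₀ (by norm_num) h2 N
    _ = exp (N : ℝ) := by rw [← exp_nat_mul, mul_one]

/-- The exponent inequality behind the abundance of certified average-case hard tables:
`1 + cℓ + 9(ℓ + 2^{⌊ℓ/8⌋} + 2)² ≤ 2^{ℓ - 2⌊ℓ/8⌋ + 1}` once `ℓ ≥ 8(8c + 7)`. [folklore] -/
theorem exponent_le_eighth (c ℓ : ℕ) (hℓ : 8 * (8 * c + 7) ≤ ℓ) :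
    1 + c * ℓ + 9 * (ℓ + 2 ^ (ℓ / 8) + 2) ^ 2 ≤ 2 ^ (ℓ - 2 * (ℓ / 8) + 1) := by
  set u := ℓ / 8 with hu
  have hcu : 8 * c + 7 ≤ u := by rw [hu]; omega
  have hℓu : ℓ ≤ 8 * u + 7 := by rw [hu]; omega
  have h8u : 8 * u ≤ ℓ := by rw [hu]; omega
  have hu1 : 1 ≤ 2 ^ u := Nat.one_le_two_pow
  -- `ℓ + 2^u + 2 ≤ 2 · 2^u`
  have hlt := @Nat.lt_two_pow_self u
  have h2u : 8 * u + 9 ≤ 2 ^ u := by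
    -- `2^u ≥ 2^7 · … `: from `u ≥ 7`, `2^u = 2^(u-7) 2^7 ≥ (u - 6) · 128`
    obtain ⟨w, hw⟩ : ∃ w, u = w + 7 := ⟨u - 7, by omega⟩
    rw [hw, pow_add]
    have := @Nat.lt_two_pow_self w
    have h128 : (2 : ℕ) ^ 7 = 128 := by norm_num
    rw [h128]
    omega
  have hbase : ℓ + 2 ^ u + 2 ≤ 2 * 2 ^ u := by omega
  have hsq : 9 * (ℓ + 2 ^ u + 2) ^ 2 ≤ 36 * 4 ^ u := by
    have h := Nat.mul_le_mul hbase hbase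
    have : 4 ^ u = 2 ^ u * 2 ^ u := by rw [show (4 : ℕ) = 2 * 2 by norm_num, mul_pow]
    nlinarith
  have hlin : 1 + c * ℓ ≤ 4 ^ u := by
    have h1 : 1 + c * ℓ ≤ (1 + 8 * c) * (u + 1) := by nlinarith
    have h2 : (1 + 8 * c) * (u + 1) ≤ 2 ^ u * 2 ^ u := Nat.mul_le_mul (by omega) (by omega)
    have : 4 ^ u = 2 ^ u * 2 ^ u := by rw [show (4 : ℕ) = 2 * 2 by norm_num, mul_pow]
    omega
  have h16 : 19 ≤ 16 ^ u := by
    calc (19 : ℕ) ≤ 16 ^ 2 := by norm_num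
      _ ≤ 16 ^ u := Nat.pow_le_pow_right (by norm_num) (by omega)
  have hpow : 37 * 4 ^ u ≤ 2 ^ (6 * u + 1) := by
    have : 2 ^ (6 * u + 1) = 2 * (4 ^ u * 16 ^ u) := by
      rw [pow_succ, show (4 : ℕ) = 2 ^ 2 by norm_num, show (16 : ℕ) = 2 ^ 4 by norm_num, ← pow_mul, ← pow_mul,
        ← pow_add]
      ring_nf
    rw [this]
    nlinarith
  have hmono : 2 ^ (6 * u + 1) ≤ 2 ^ (ℓ - 2 * (ℓ / 8) + 1) :=
    Nat.pow_le_pow_right two_pos (by rw [← hu]; omega)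
  calc 1 + c * ℓ + 9 * (ℓ + 2 ^ (ℓ / 8) + 2) ^ 2 ≤ 4 ^ u + 36 * 4 ^ u := Nat.add_le_add hlin hsq
    _ = 37 * 4 ^ u := by ring
    _ ≤ 2 ^ (6 * u + 1) := hpow
    _ ≤ 2 ^ (ℓ - 2 * (ℓ / 8) + 1) := hmono

/-- Real form: `2^{9(ℓ + 2^{⌊ℓ/8⌋} + 2)²} · exp(-2·2^ℓ/(2^{⌊ℓ/8⌋})²) ≤ 1/(2 (2^ℓ)^c)` for `ℓ ≥ 8(8c + 7)`.
[folklore] -/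
theorem density_eighthExp_le (c ℓ : ℕ) (hℓ : 8 * (8 * c + 7) ≤ ℓ) :
    (2 : ℝ) ^ (9 * (ℓ + eighthExp ℓ + 2) ^ 2) * exp (-2 * (2 ^ ℓ : ℝ) / (eighthExp ℓ : ℝ) ^ 2) ≤
      1 / (2 * ((2 : ℝ) ^ ℓ) ^ c) := by
  have hexp := exponent_le_eighth c ℓ hℓ
  set u := ℓ / 8 with hu
  have h2u : 2 * u ≤ ℓ := by rw [hu]; omega
  -- the exponent of the exponential is the natural number `2^{ℓ - 2u + 1}`
  have hN : -2 * (2 ^ ℓ : ℝ) / (eighthExp ℓ : ℝ) ^ 2 = -((2 ^ (ℓ - 2 * u + 1) : ℕ) : ℝ) := by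
    unfold eighthExp
    rw [← hu]
    push_cast
    have h1 : (2 : ℝ) ^ ℓ = 2 ^ (ℓ - 2 * u) * (2 ^ u) ^ 2 := by
      rw [← pow_mul, ← pow_add]; congr 1; omega
    rw [h1, pow_succ]
    field_simp
    ring
  rw [hN]
  have hE := exp_neg_natCast_le (2 ^ (ℓ - 2 * u + 1))
  have hpos : (0 : ℝ) ≤ (2 : ℝ) ^ (9 * (ℓ + eighthExp ℓ + 2) ^ 2) := by positivity
  refine (mul_le_mul_of_nonneg_left hE hpos).trans ?_
  rw [mul_one_div, div_le_div_iff₀ (by positivity) (by positivity), one_mul]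
  have h : (2 : ℝ) ^ (9 * (ℓ + eighthExp ℓ + 2) ^ 2) * (2 * ((2 : ℝ) ^ ℓ) ^ c) =
      2 ^ (1 + c * ℓ + 9 * (ℓ + 2 ^ (ℓ / 8) + 2) ^ 2) := by
    rw [eighthExp, ← pow_mul, pow_add, pow_add, pow_one]
    ring
  rw [h]
  refine pow_le_pow_right₀ one_le_two ?_
  rw [← hu]
  exact hexp

/-- **Köbler–Schuler certified AVERAGE-case hardness under `coNP × {U} ⊆ Avg¹_{1-n^{-c}} P`, at
threshold `2^{⌊ℓ/8⌋}`**, given `ApproxTables eighthExp ∈ NP`: a polynomial-time `A(w; 1ⁿ)`, a constant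
`c` and `ℓ₀` such that every accepted table `A(tt(f); 1^{2^ℓ}) = 1` has `H_avg(f) ≥ 2^{⌊ℓ/8⌋}`; for all
`ℓ ≥ ℓ₀` a uniformly random table of length `2^ℓ` is accepted with probability `≥ 1/(2 (2^ℓ)^c)`; in
particular for all `ℓ ≥ ℓ₀` some `ℓ`-variable function is accepted (and thereby certified hard on average).
[Hirahara 2021 (ECCC TR21-058), Lemma 3.4, proof sketch, item 2 (p. 20); Köbler–Schuler 2004;
Arora–Barak 2009, Def. 19.1, Thm. 6.21] [cite: Hirahara2021, Lemma 3.4 (proof sketch, item 2)] -/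
theorem exists_avgCertifier_eighthExp
    (hU : ∃ c : ℕ, distClass coNP {uniformEnsemble} ⊆ Avg1DeltaP fun n => 1 - 1 / (n : ℝ) ^ c)
    (hNP : ApproxTables eighthExp ∈ NP) :
    ∃ (A : List Bool → ℕ → Bool) (c ℓ₀ : ℕ),
      PolyTimeComputable paramEnc encodeBool (Function.uncurry A) ∧
      (∀ (ℓ : ℕ) (f : (Fin ℓ → Bool) → Bool), A (truthTable f) (2 ^ ℓ) = true →
        AvgHardAtLeast f ((2 : ℝ) ^ (ℓ / 8))) ∧
      (∀ ℓ : ℕ, ℓ₀ ≤ ℓ → 1 / (2 * ((2 : ℝ) ^ ℓ) ^ c) ≤ uniformProb (2 ^ ℓ) {w | A w (2 ^ ℓ) = true}) ∧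
      ∀ ℓ : ℕ, ℓ₀ ≤ ℓ → ∃ f : (Fin ℓ → Bool) → Bool, A (truthTable f) (2 ^ ℓ) = true := by
  obtain ⟨A, c, hA, hsound, habund⟩ := exists_avgCertifier hU one_le_eighthExp hNP
  have hbound : ∀ ℓ : ℕ, 8 * (8 * c + 7) ≤ ℓ →
      1 / (2 * ((2 : ℝ) ^ ℓ) ^ c) ≤ uniformProb (2 ^ ℓ) {w | A w (2 ^ ℓ) = true} := by
    intro ℓ hℓ
    have h1 := habund ℓ
    have h2 := density_eighthExp_le c ℓ hℓ
    have h3 : 1 / ((2 : ℝ) ^ ℓ) ^ c = 1 / (2 * ((2 : ℝ) ^ ℓ) ^ c) + 1 / (2 * ((2 : ℝ) ^ ℓ) ^ c) := by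
      field_simp; ring
    linarith
  refine ⟨A, c, 8 * (8 * c + 7), hA, fun ℓ f h => ?_, hbound, fun ℓ hℓ => ?_⟩
  · have := hsound ℓ f h
    unfold eighthExp at this
    exact_mod_cast this
  · have hpos : 0 < uniformProb (2 ^ ℓ) {w | A w (2 ^ ℓ) = true} :=
      lt_of_lt_of_le (by positivity) (hbound ℓ hℓ)
    unfold uniformProb at hpos
    rw [div_pos_iff_of_pos_right (by positivity), Nat.cast_pos, Finset.card_pos] at hpos
    obtain ⟨r, hr⟩ := hpos
    simp only [Finset.mem_filter, Finset.mem_univ, true_and, Set.mem_setOf_eq] at hr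
    refine ⟨ofTruthTable r.toList (by simp), ?_⟩
    rw [truthTable_ofTruthTable]
    exact hr

end AvgHardTables

end Literature.Computability.MetaComplexity

end
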